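import Mathlib
import Summits.NavierStokesRegularity.NavierStokesRegularity.Theorems.EulerZoomLiouvillePowerGaugeEulerLiouvilleWeakChainRule
import Summits.NavierStokesRegularity.NavierStokesRegularity.Theorems.EulerZoomLiouvillePowerGaugeEulerLiouvilleWeakBernoulliClock
import HarnessLib

/-!
# Crux `EulerZoomLiouville.PowerGaugeEulerLiouville` (stmt-NavierStokesRegularity-19832), weak stratum, line `weak_lagrangian` (ns-idea-11 g9):
# LAGRANGIAN TRANSPORT OF THE VELOCITY PROFILE AND OF THE PRESSURE ALONG A.E. BACKWARD ORBIT (corollaries of F2)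

Route №10 `EulerZoomLiouville` (NavierStokesRegularity), crux E = stmt-NavierStokesRegularity-19832; width seat ns-ezl-w1 g8 under the LEAD ns-typeII-p2 g15.
With F2 (`WeakLagrangian.chainRule_core`, p694614) a THEOREM, every Sobolev observable of the weak member is transported along a.e. orbit of the backward flow
`Ψ` of `−W` (hypothesis M1: jointly measurable, a.e. integral curves, exact Jacobian law).  Two portrait bricks for the weak needle face:

* `hasWeakFDerivOn_clm_comp` — a continuous linear map of a weakly differentiable function is weakly differentiable (`D(L∘f) = L∘Df`);
* `velocity_transport` — **MOMENTUM ALONG BACKWARD ORBITS**: for the velocity profile `V ∈ W^{1,2}_loc` (weak gradient `G ∈ L²_loc`), for every `σ ≥ 0` and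
  a.e. label, `V(Ψ_σ y) = V(y) − ∫₀^σ G(Ψ_s y)[W(Ψ_s y)] ds` (componentwise F2 with the observables `y ↦ (V y)ᵢ`);
* `pressure_transport` — **PRESSURE ALONG BACKWARD ORBITS**: with the weak pressure-gradient law `DP = −⟪G(W) + (1−γ)V, ·⟫` (tree
  `WeakPressure.hasWeakFDerivOn_pressure`), `P(Ψ_σ y) = P(y) + ∫₀^σ ⟪G(Ψ_s y)[W(Ψ_s y)] + (1−γ)V(Ψ_s y), W(Ψ_s y)⟫ ds` for a.e. label
  (`DP ∈ L^{3/2}_loc` by Hölder `2⁻¹ + 6⁻¹ = (3/2)⁻¹`).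
Together with the profile equation `G(W) = −(1−γ)V − ∇P` these are Newton's law `dV/dσ = (1−γ)V + ∇P` and `dP/dσ = −⟪∇P, W⟩ + …` along backward
orbits, in a.e. binders and integral form — conditional only on M1.

WHAT THIS IS NOT: not NS, not E, not M1 — 19832 is OPEN. [folklore; ConstantinIgnatovaVicol2026Putative §3.4 (the Lagrangian picture); AmbrosioCrippa2008 §5]
-/

noncomputable section

-- flat `Theorems/<Route><Decl>…` files of one crux share the namespace of the crux (tree convention)
set_option linter.dupNamespace false

open MeasureTheory Set Filter Topology Metric Function TopologicalSpace ContinuousLinearMap intervalIntegral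
open scoped ENNReal NNReal InnerProductSpace RealInnerProductSpace ContDiff

namespace Summit.NavierStokesRegularity.NavierStokesRegularity.Theorems.PowerGaugeEulerLiouville.WeakLagrangian

open Literature.Analysis Literature.Analysis.FunctionSpaces Literature.Analysis.FluidPDE
open Summit.NavierStokesRegularity.NavierStokesRegularity.Theorems.PowerGaugeEulerLiouville

/-! ### A continuous linear map of a weakly differentiable function -/

/-- **`D(L ∘ f) = L ∘ Df` weakly** (whole space `ℝ³`): if `g` is a weak derivative of `f`, then `x ↦ L ∘ g x` is a weak derivative of `L ∘ f`.
[folklore; Evans2010 §5.2.1] -/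
theorem hasWeakFDerivOn_clm_comp {F F' : Type*}
    [NormedAddCommGroup F] [NormedSpace ℝ F] [CompleteSpace F] [NormedAddCommGroup F'] [NormedSpace ℝ F'] [CompleteSpace F']
    {f : EuclideanSpace ℝ (Fin 3) → F} {g : EuclideanSpace ℝ (Fin 3) → EuclideanSpace ℝ (Fin 3) →L[ℝ] F}
    (hf : HasWeakFDerivOn (⊤ : Opens (EuclideanSpace ℝ (Fin 3))) volume f g) (L : F →L[ℝ] F') :
    HasWeakFDerivOn (⊤ : Opens (EuclideanSpace ℝ (Fin 3))) volume (fun x => L (f x)) (fun x => L.comp (g x)) := by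
  have hfl : LocallyIntegrable f volume := locallyIntegrableOn_univ.1 (by
    simpa only [Opens.coe_top] using hf.locallyIntegrableOn)
  have hgl : LocallyIntegrable g volume := locallyIntegrableOn_univ.1 (by
    simpa only [Opens.coe_top] using hf.locallyIntegrableOn_deriv)
  refine ⟨L.locallyIntegrableOn_comp hf.locallyIntegrableOn, ?_, fun φ v hφ => ?_⟩
  · exact ((ContinuousLinearMap.compL ℝ (EuclideanSpace ℝ (Fin 3)) F F') L).locallyIntegrableOn_comp hf.locallyIntegrableOn_deriv
  · have h := hf.integral_fderiv_smul_eq φ v hφ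
    simp only [Opens.coe_top, Measure.restrict_univ] at h ⊢
    have hdφc : Continuous fun x => fderiv ℝ φ x v := (hφ.contDiff.continuous_fderiv (by simp)).clm_apply continuous_const
    have hdφs : HasCompactSupport fun x => fderiv ℝ φ x v := hφ.hasCompactSupport.fderiv_apply (𝕜 := ℝ) v
    have hI1 : Integrable (fun x => (fderiv ℝ φ x v) • f x) volume := hfl.integrable_smul_left_of_hasCompactSupport hdφc hdφs
    have hI2 : Integrable (fun x => φ x • g x v) volume :=
      (((ContinuousLinearMap.apply ℝ F v).locallyIntegrableOn_comp (locallyIntegrableOn_univ.2 hgl)) |> locallyIntegrableOn_univ.1)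
        |>.integrable_smul_left_of_hasCompactSupport hφ.contDiff.continuous hφ.hasCompactSupport
    calc ∫ x, (fderiv ℝ φ x v) • L (f x) = ∫ x, L ((fderiv ℝ φ x v) • f x) := by simp only [map_smul]
      _ = L (∫ x, (fderiv ℝ φ x v) • f x) := L.integral_comp_comm hI1
      _ = L (-∫ x, φ x • g x v) := by rw [h]
      _ = -∫ x, φ x • L (g x v) := by rw [map_neg, ← L.integral_comp_comm hI2]; simp only [map_smul]
      _ = -∫ x, φ x • (L.comp (g x)) v := by rfl

/-! ### Momentum along backward orbits -/

section Transport

variable {γ₀ : ℝ} {V : EuclideanSpace ℝ (Fin 3) → EuclideanSpace ℝ (Fin 3)}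
  {G : EuclideanSpace ℝ (Fin 3) → EuclideanSpace ℝ (Fin 3) →L[ℝ] EuclideanSpace ℝ (Fin 3)}
  {Ψ : ℝ → EuclideanSpace ℝ (Fin 3) → EuclideanSpace ℝ (Fin 3)}

/-- A coordinate of an `L²(B(0,r))` operator field is in `L^{3/2}(B(0,r))` (`‖πᵢ ∘ G x‖ ≤ ‖G x‖`, finite measure). [folklore] -/
theorem memLp_proj_comp_threeHalves {r : ℝ} (hG2 : MemLp G 2 (volume.restrict (ball (0 : EuclideanSpace ℝ (Fin 3)) r))) (i : Fin 3) :
    MemLp (fun x => (EuclideanSpace.proj i : EuclideanSpace ℝ (Fin 3) →L[ℝ] ℝ).comp (G x)) (3 / 2 : ℝ≥0∞)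
      (volume.restrict (ball (0 : EuclideanSpace ℝ (Fin 3)) r)) := by
  haveI : IsFiniteMeasure ((volume : Measure (EuclideanSpace ℝ (Fin 3))).restrict (ball (0 : EuclideanSpace ℝ (Fin 3)) r)) :=
    isFiniteMeasure_restrict.2 measure_ball_lt_top.ne
  have h32 : (3 / 2 : ℝ≥0∞) ≤ 2 := by
    rw [ENNReal.div_le_iff (by norm_num) (by norm_num)]; norm_num
  have h2 : MemLp (fun x => (EuclideanSpace.proj i : EuclideanSpace ℝ (Fin 3) →L[ℝ] ℝ).comp (G x)) 2
      (volume.restrict (ball (0 : EuclideanSpace ℝ (Fin 3)) r)) := by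
    refine hG2.of_le_mul (c := ‖(EuclideanSpace.proj i : EuclideanSpace ℝ (Fin 3) →L[ℝ] ℝ)‖) ?_ (Eventually.of_forall fun x => ?_)
    · exact ((ContinuousLinearMap.compL ℝ (EuclideanSpace ℝ (Fin 3)) (EuclideanSpace ℝ (Fin 3)) ℝ)
        (EuclideanSpace.proj i : EuclideanSpace ℝ (Fin 3) →L[ℝ] ℝ)).continuous.comp_aestronglyMeasurable hG2.1
    · exact (EuclideanSpace.proj i : EuclideanSpace ℝ (Fin 3) →L[ℝ] ℝ).opNorm_comp_le (G x)
  exact h2.mono_exponent h32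

/-- **THE VELOCITY PROFILE IS TRANSPORTED ALONG A.E. BACKWARD ORBIT** (Newton's law in integral form, conditional on the flow): `γ ≥ 0`; `V` with
whole-space weak gradient `G ∈ L²(B(0,r))`, `V ∈ L⁶(B(0,r))` for all `r`; `Ψ` jointly measurable, a.e. label an integral curve of `−W` (`W = γy + V`) in
integral form, Jacobian law `(Ψ_σ)_# vol = e^{3γσ} vol`.  Then for every `σ ≥ 0` and a.e. `y`: `s ↦ G(Ψ_s y)[W(Ψ_s y)]` is integrable on `(0,σ)` and
`V(Ψ_σ y) = V(y) − ∫₀^σ G(Ψ_s y)[W(Ψ_s y)] ds` (componentwise `chainRule_core` with the observables `y ↦ (V y)ᵢ`). [folklore; AmbrosioCrippa2008 §5] -/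
theorem velocity_transport (hγ₀ : 0 ≤ γ₀)
    (hVG : HasWeakFDerivOn (⊤ : Opens (EuclideanSpace ℝ (Fin 3))) volume V G)
    (hG2 : ∀ r : ℝ, MemLp G 2 (volume.restrict (ball (0 : EuclideanSpace ℝ (Fin 3)) r)))
    (hV6 : ∀ r : ℝ, MemLp V 6 (volume.restrict (ball (0 : EuclideanSpace ℝ (Fin 3)) r)))
    (hΨm : Measurable (Function.uncurry Ψ))
    (hcurve : ∀ᵐ y ∂(volume : Measure (EuclideanSpace ℝ (Fin 3))), ∀ σ : ℝ, 0 ≤ σ →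
      IntervalIntegrable (fun s => selfSimilarTransport γ₀ 0 V (Ψ s y)) volume 0 σ ∧
        Ψ σ y = y - ∫ s in (0 : ℝ)..σ, selfSimilarTransport γ₀ 0 V (Ψ s y))
    (hjac : ∀ σ : ℝ, 0 ≤ σ →
      Measure.map (Ψ σ) (volume : Measure (EuclideanSpace ℝ (Fin 3))) =
        ENNReal.ofReal (Real.exp (3 * γ₀ * σ)) • (volume : Measure (EuclideanSpace ℝ (Fin 3))))
    {σ : ℝ} (hσ : 0 ≤ σ) :
    ∀ᵐ y ∂(volume : Measure (EuclideanSpace ℝ (Fin 3))),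
      IntervalIntegrable (fun s => G (Ψ s y) (selfSimilarTransport γ₀ 0 V (Ψ s y))) volume 0 σ ∧
        V (Ψ σ y) = V y - ∫ s in (0 : ℝ)..σ, G (Ψ s y) (selfSimilarTransport γ₀ 0 V (Ψ s y)) := by
  have hVm : AEStronglyMeasurable V volume := by
    have h := hVG.locallyIntegrableOn.aestronglyMeasurable
    simpa only [Opens.coe_top, Measure.restrict_univ] using h
  -- ### componentwise chain rule
  have hcomp : ∀ i : Fin 3, ∀ᵐ y ∂(volume : Measure (EuclideanSpace ℝ (Fin 3))),
      IntervalIntegrable (fun s => ((EuclideanSpace.proj i : EuclideanSpace ℝ (Fin 3) →L[ℝ] ℝ).comp (G (Ψ s y)))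
          (selfSimilarTransport γ₀ 0 V (Ψ s y))) volume 0 σ ∧
        (EuclideanSpace.proj i : EuclideanSpace ℝ (Fin 3) →L[ℝ] ℝ) (V (Ψ σ y)) =
          (EuclideanSpace.proj i : EuclideanSpace ℝ (Fin 3) →L[ℝ] ℝ) (V y) -
            ∫ s in (0 : ℝ)..σ, ((EuclideanSpace.proj i : EuclideanSpace ℝ (Fin 3) →L[ℝ] ℝ).comp (G (Ψ s y)))
              (selfSimilarTransport γ₀ 0 V (Ψ s y)) := fun i =>
    chainRule_core hγ₀ hVm hV6 hΨm hcurve hjac (hasWeakFDerivOn_clm_comp hVG (EuclideanSpace.proj i : EuclideanSpace ℝ (Fin 3) →L[ℝ] ℝ))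
      (fun r => memLp_proj_comp_threeHalves (hG2 r) i) hσ
  have hall : ∀ᵐ y ∂(volume : Measure (EuclideanSpace ℝ (Fin 3))), ∀ i : Fin 3,
      IntervalIntegrable (fun s => ((EuclideanSpace.proj i : EuclideanSpace ℝ (Fin 3) →L[ℝ] ℝ).comp (G (Ψ s y)))
          (selfSimilarTransport γ₀ 0 V (Ψ s y))) volume 0 σ ∧
        (EuclideanSpace.proj i : EuclideanSpace ℝ (Fin 3) →L[ℝ] ℝ) (V (Ψ σ y)) =
          (EuclideanSpace.proj i : EuclideanSpace ℝ (Fin 3) →L[ℝ] ℝ) (V y) -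
            ∫ s in (0 : ℝ)..σ, ((EuclideanSpace.proj i : EuclideanSpace ℝ (Fin 3) →L[ℝ] ℝ).comp (G (Ψ s y)))
              (selfSimilarTransport γ₀ 0 V (Ψ s y)) := ae_all_iff.2 hcomp
  filter_upwards [hall] with y hy
  -- ### assemble the vector identity
  have hint : IntervalIntegrable (fun s => G (Ψ s y) (selfSimilarTransport γ₀ 0 V (Ψ s y))) volume 0 σ := by
    rw [intervalIntegrable_iff]
    refine Integrable.of_eval_piLp fun i => ?_
    have h := (hy i).1
    rw [intervalIntegrable_iff] at h
    exact h
  refine ⟨hint, PiLp.ext fun i => ?_⟩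
  have h := (hy i).2
  simp only [ContinuousLinearMap.coe_comp, Function.comp_apply, PiLp.proj_apply] at h
  rw [PiLp.sub_apply, h, ← PiLp.proj_apply (𝕜 := ℝ) 2 (fun _ : Fin 3 => ℝ) i (∫ s in (0 : ℝ)..σ, G (Ψ s y) (selfSimilarTransport γ₀ 0 V (Ψ s y))),
    ← ContinuousLinearMap.intervalIntegral_comp_comm _ hint]
  rfl

/-- **THE TRANSPORT FIELD ALONG A.E. BACKWARD ORBIT** (Lagrangian acceleration `dW/dσ = −DW·W`): under the hypotheses of `velocity_transport`,
for every `σ ≥ 0` and a.e. `y`, `W(Ψ_σ y) = W(y) − ∫₀^σ (γ W + G[W])(Ψ_s y) ds` with `W = γy + V`, `DW = γ I + G`. [folklore] -/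
theorem transport_transport (hγ₀ : 0 ≤ γ₀)
    (hVG : HasWeakFDerivOn (⊤ : Opens (EuclideanSpace ℝ (Fin 3))) volume V G)
    (hG2 : ∀ r : ℝ, MemLp G 2 (volume.restrict (ball (0 : EuclideanSpace ℝ (Fin 3)) r)))
    (hV6 : ∀ r : ℝ, MemLp V 6 (volume.restrict (ball (0 : EuclideanSpace ℝ (Fin 3)) r)))
    (hΨm : Measurable (Function.uncurry Ψ))
    (hcurve : ∀ᵐ y ∂(volume : Measure (EuclideanSpace ℝ (Fin 3))), ∀ σ : ℝ, 0 ≤ σ →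
      IntervalIntegrable (fun s => selfSimilarTransport γ₀ 0 V (Ψ s y)) volume 0 σ ∧
        Ψ σ y = y - ∫ s in (0 : ℝ)..σ, selfSimilarTransport γ₀ 0 V (Ψ s y))
    (hjac : ∀ σ : ℝ, 0 ≤ σ →
      Measure.map (Ψ σ) (volume : Measure (EuclideanSpace ℝ (Fin 3))) =
        ENNReal.ofReal (Real.exp (3 * γ₀ * σ)) • (volume : Measure (EuclideanSpace ℝ (Fin 3))))
    {σ : ℝ} (hσ : 0 ≤ σ) :
    ∀ᵐ y ∂(volume : Measure (EuclideanSpace ℝ (Fin 3))),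
      IntervalIntegrable (fun s => γ₀ • selfSimilarTransport γ₀ 0 V (Ψ s y) + G (Ψ s y) (selfSimilarTransport γ₀ 0 V (Ψ s y))) volume 0 σ ∧
        selfSimilarTransport γ₀ 0 V (Ψ σ y) = selfSimilarTransport γ₀ 0 V y -
          ∫ s in (0 : ℝ)..σ, (γ₀ • selfSimilarTransport γ₀ 0 V (Ψ s y) + G (Ψ s y) (selfSimilarTransport γ₀ 0 V (Ψ s y))) := by
  filter_upwards [velocity_transport hγ₀ hVG hG2 hV6 hΨm hcurve hjac hσ, hcurve] with y hy hyc
  obtain ⟨hI1, e1⟩ := hyc σ hσ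
  obtain ⟨hI2, e2⟩ := hy
  have hI1' : IntervalIntegrable (fun s => γ₀ • selfSimilarTransport γ₀ 0 V (Ψ s y)) volume 0 σ := hI1.smul γ₀
  refine ⟨hI1'.add hI2, ?_⟩
  rw [intervalIntegral.integral_add hI1' hI2, intervalIntegral.integral_smul]
  simp only [selfSimilarTransport, sub_zero] at e1 e2 ⊢
  rw [e2]
  -- `W(Ψσ y) = γ Ψσ y + V(Ψσ y)`; substitute the orbit equation for `Ψσ y` once, on the left
  conv_lhs => rw [e1]
  simp only [smul_sub]
  abel

/-! ### Pressure along backward orbits -/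

/-- The weak pressure gradient `−⟪G[W] + (1−γ)V, ·⟫` lies in `L^{3/2}(B(0,r))` (`‖·‖ ≤ ‖G‖‖W‖ + |1−γ|‖V‖`; Hölder `2⁻¹ + 6⁻¹ = (3/2)⁻¹`, `L⁶ ⊂ L^{3/2}`
on the ball). [folklore] -/
theorem memLp_pressureGradient_threeHalves {r : ℝ}
    (hV6 : MemLp V 6 (volume.restrict (ball (0 : EuclideanSpace ℝ (Fin 3)) r)))
    (hG2 : MemLp G 2 (volume.restrict (ball (0 : EuclideanSpace ℝ (Fin 3)) r)))
    (hm : AEStronglyMeasurable (fun x => -(innerSL ℝ (G x (selfSimilarTransport γ₀ 0 V x) + (1 - γ₀) • V x)))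
      (volume.restrict (ball (0 : EuclideanSpace ℝ (Fin 3)) r))) :
    MemLp (fun x => -(innerSL ℝ (G x (selfSimilarTransport γ₀ 0 V x) + (1 - γ₀) • V x))) (3 / 2 : ℝ≥0∞)
      (volume.restrict (ball (0 : EuclideanSpace ℝ (Fin 3)) r)) := by
  haveI : IsFiniteMeasure ((volume : Measure (EuclideanSpace ℝ (Fin 3))).restrict (ball (0 : EuclideanSpace ℝ (Fin 3)) r)) :=
    isFiniteMeasure_restrict.2 measure_ball_lt_top.ne
  haveI := ProfileEnergy.holderTriple_two_six_threeHalves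
  have hW := WeakRenormalized.memLp_transport_six (γ := γ₀) hV6
  have h32 : (3 / 2 : ℝ≥0∞) ≤ 6 := by
    rw [ENNReal.div_le_iff (by norm_num) (by norm_num)]; norm_num
  have hdom1 : MemLp (fun x => ‖G x‖ * ‖selfSimilarTransport γ₀ 0 V x‖) (3 / 2 : ℝ≥0∞)
      (volume.restrict (ball (0 : EuclideanSpace ℝ (Fin 3)) r)) :=
    MemLp.mul (p := 2) (q := 6) (r := (3 / 2 : ℝ≥0∞)) hW.norm hG2.norm
  have hdom2 : MemLp (fun x => |1 - γ₀| * ‖V x‖) (3 / 2 : ℝ≥0∞) (volume.restrict (ball (0 : EuclideanSpace ℝ (Fin 3)) r)) :=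
    (hV6.mono_exponent h32).norm.const_mul _
  refine MemLp.of_le (hdom1.add hdom2) hm (Eventually.of_forall fun x => ?_)
  have hpos : 0 ≤ ‖G x‖ * ‖selfSimilarTransport γ₀ 0 V x‖ + |1 - γ₀| * ‖V x‖ := by positivity
  rw [Pi.add_apply, Real.norm_of_nonneg hpos, norm_neg, innerSL_apply_norm]
  calc ‖G x (selfSimilarTransport γ₀ 0 V x) + (1 - γ₀) • V x‖
      ≤ ‖G x (selfSimilarTransport γ₀ 0 V x)‖ + ‖(1 - γ₀) • V x‖ := norm_add_le _ _
    _ ≤ ‖G x‖ * ‖selfSimilarTransport γ₀ 0 V x‖ + |1 - γ₀| * ‖V x‖ := by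
        rw [norm_smul, Real.norm_eq_abs]; exact add_le_add ((G x).le_opNorm _) le_rfl

/-- **THE PRESSURE IS TRANSPORTED ALONG A.E. BACKWARD ORBIT**: under the flow hypotheses of `velocity_transport` and the weak pressure-gradient law
`DP = −⟪G[W] + (1−γ)V, ·⟫` (tree `WeakPressure.hasWeakFDerivOn_pressure` for class members), for every `σ ≥ 0` and a.e. `y`:
`P(Ψ_σ y) = P(y) + ∫₀^σ ⟪G(Ψ_s y)[W(Ψ_s y)] + (1−γ) V(Ψ_s y), W(Ψ_s y)⟫ ds`. [folklore; AmbrosioCrippa2008 §5] -/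
theorem pressure_transport {P : EuclideanSpace ℝ (Fin 3) → ℝ} (hγ₀ : 0 ≤ γ₀)
    (hVG : HasWeakFDerivOn (⊤ : Opens (EuclideanSpace ℝ (Fin 3))) volume V G)
    (hG2 : ∀ r : ℝ, MemLp G 2 (volume.restrict (ball (0 : EuclideanSpace ℝ (Fin 3)) r)))
    (hV6 : ∀ r : ℝ, MemLp V 6 (volume.restrict (ball (0 : EuclideanSpace ℝ (Fin 3)) r)))
    (hPG : HasWeakFDerivOn (⊤ : Opens (EuclideanSpace ℝ (Fin 3))) volume P
      (fun x => -(innerSL ℝ (G x (selfSimilarTransport γ₀ 0 V x) + (1 - γ₀) • V x))))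
    (hΨm : Measurable (Function.uncurry Ψ))
    (hcurve : ∀ᵐ y ∂(volume : Measure (EuclideanSpace ℝ (Fin 3))), ∀ σ : ℝ, 0 ≤ σ →
      IntervalIntegrable (fun s => selfSimilarTransport γ₀ 0 V (Ψ s y)) volume 0 σ ∧
        Ψ σ y = y - ∫ s in (0 : ℝ)..σ, selfSimilarTransport γ₀ 0 V (Ψ s y))
    (hjac : ∀ σ : ℝ, 0 ≤ σ →
      Measure.map (Ψ σ) (volume : Measure (EuclideanSpace ℝ (Fin 3))) =
        ENNReal.ofReal (Real.exp (3 * γ₀ * σ)) • (volume : Measure (EuclideanSpace ℝ (Fin 3))))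
    {σ : ℝ} (hσ : 0 ≤ σ) :
    ∀ᵐ y ∂(volume : Measure (EuclideanSpace ℝ (Fin 3))),
      IntervalIntegrable (fun s => ⟪G (Ψ s y) (selfSimilarTransport γ₀ 0 V (Ψ s y)) + (1 - γ₀) • V (Ψ s y),
          selfSimilarTransport γ₀ 0 V (Ψ s y)⟫) volume 0 σ ∧
        P (Ψ σ y) = P y + ∫ s in (0 : ℝ)..σ, ⟪G (Ψ s y) (selfSimilarTransport γ₀ 0 V (Ψ s y)) + (1 - γ₀) • V (Ψ s y),
          selfSimilarTransport γ₀ 0 V (Ψ s y)⟫ := by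
  have hVm : AEStronglyMeasurable V volume := by
    have h := hVG.locallyIntegrableOn.aestronglyMeasurable
    simpa only [Opens.coe_top, Measure.restrict_univ] using h
  have hgm : AEStronglyMeasurable (fun x => -(innerSL ℝ (G x (selfSimilarTransport γ₀ 0 V x) + (1 - γ₀) • V x))) volume := by
    have h := hPG.locallyIntegrableOn_deriv.aestronglyMeasurable
    simpa only [Opens.coe_top, Measure.restrict_univ] using h
  have h := chainRule_core hγ₀ hVm hV6 hΨm hcurve hjac hPG (fun r => memLp_pressureGradient_threeHalves (hV6 r) (hG2 r) hgm.restrict) hσ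
  filter_upwards [h] with y hy
  obtain ⟨hI, e⟩ := hy
  simp only [_root_.neg_apply, innerSL_apply_apply] at hI e
  refine ⟨by simpa only [Pi.neg_def, neg_neg] using hI.neg, ?_⟩
  rw [e, intervalIntegral.integral_neg, sub_neg_eq_add]

end Transport

/-! ### Member-level corollaries (the line's binder shape) -/

section Member

/-- **MOMENTUM AND PRESSURE ALONG A.E. BACKWARD ORBIT OF A WEAK CLASS MEMBER** (line `weak_lagrangian`, binder shape of `stub_chainRule`, with
`InClass`, `IsExactlySelfSimilar`, `IsProfileGradient`, `IsBackwardFlow` δ-unfolded): for every `σ ≥ 0` and a.e. label `y`,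
`V(Ψ_σ y) = V(y) − ∫₀^σ G[W](Ψ_s y) ds` and `P(Ψ_σ y) = P(y) + ∫₀^σ ⟪G[W] + (1−γ)V, W⟫(Ψ_s y) ds`, `γ = 1/(2+ρ)`, `W = γy + V`; the pressure law is the tree's
`WeakPressure.hasWeakFDerivOn_pressure` for the line's gradient `G` (class data via `Past.profileData_of_past`). [folklore; AmbrosioCrippa2008 §5] -/
theorem momentum_transport_of_selfSimilar {ρ : ℝ} (hρ : 0 < ρ) (hρh : ρ ≤ 1 / 2)
    {u : ℝ → EuclideanSpace ℝ (Fin 3) → EuclideanSpace ℝ (Fin 3)} {p : ℝ → EuclideanSpace ℝ (Fin 3) → ℝ}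
    {H : ℝ → EuclideanSpace ℝ (Fin 3) → EuclideanSpace ℝ (Fin 3) →L[ℝ] EuclideanSpace ℝ (Fin 3)} {c : ℝ≥0}
    {V : EuclideanSpace ℝ (Fin 3) → EuclideanSpace ℝ (Fin 3)} {P : EuclideanSpace ℝ (Fin 3) → ℝ}
    {G : EuclideanSpace ℝ (Fin 3) → EuclideanSpace ℝ (Fin 3) →L[ℝ] EuclideanSpace ℝ (Fin 3)}
    {Ψ : ℝ → EuclideanSpace ℝ (Fin 3) → EuclideanSpace ℝ (Fin 3)}
    (hcls : IsSuitableWeakSolutionOn (slab (EuclideanSpace ℝ (Fin 3)) (Set.Iio 0) isOpen_Iio) 0 0 u p ∧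
      HasWeakSpatialGradientOn (slab (EuclideanSpace ℝ (Fin 3)) (Set.Iio 0) isOpen_Iio) u H ∧
      (∀ a : ℝ, 0 < a →
        ENNReal.ofReal (a ^ (2 * ρ)) * cknA a (0 : ℝ × EuclideanSpace ℝ (Fin 3)) u +
            ENNReal.ofReal (a ^ ρ) * cknE a (0 : ℝ × EuclideanSpace ℝ (Fin 3)) H +
          ENNReal.ofReal (a ^ (2 * ρ)) * cknD a (0 : ℝ × EuclideanSpace ℝ (Fin 3)) p ≤ (c : ℝ≥0∞)))
    (hss : (∀ τ : ℝ, τ < 0 → u τ = selfSimilarCollapse (1 / (2 + ρ)) 0 V τ) ∧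
      (∀ τ : ℝ, τ < 0 → p τ = selfSimilarCollapsePressure (1 / (2 + ρ)) 0 P τ))
    (hPG : HasWeakFDerivOn (⊤ : Opens (EuclideanSpace ℝ (Fin 3))) volume V G ∧
      (∀ r : ℝ, MemLp G 2 (volume.restrict (ball (0 : EuclideanSpace ℝ (Fin 3)) r))) ∧
      (∀ r : ℝ, MemLp V 6 (volume.restrict (ball (0 : EuclideanSpace ℝ (Fin 3)) r))) ∧
      HasWeakFDerivOn (⊤ : Opens (EuclideanSpace ℝ (Fin 3))) volume (selfSimilarTransport (1 / (2 + ρ)) 0 V)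
        (fun x => (1 / (2 + ρ)) • ContinuousLinearMap.id ℝ (EuclideanSpace ℝ (Fin 3)) + G x))
    (hΨ : Measurable (Function.uncurry Ψ) ∧
      (∀ y : EuclideanSpace ℝ (Fin 3), Ψ 0 y = y) ∧
      (∀ᵐ y ∂(volume : Measure (EuclideanSpace ℝ (Fin 3))), ∀ σ : ℝ, 0 ≤ σ →
        IntervalIntegrable (fun s => selfSimilarTransport (1 / (2 + ρ)) 0 V (Ψ s y)) volume 0 σ ∧
          Ψ σ y = y - ∫ s in (0 : ℝ)..σ, selfSimilarTransport (1 / (2 + ρ)) 0 V (Ψ s y)) ∧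
      (∀ σ s : ℝ, 0 ≤ σ → 0 ≤ s → ∀ᵐ y ∂(volume : Measure (EuclideanSpace ℝ (Fin 3))), Ψ (σ + s) y = Ψ σ (Ψ s y)) ∧
      (∀ σ : ℝ, 0 ≤ σ →
        Measure.map (Ψ σ) (volume : Measure (EuclideanSpace ℝ (Fin 3))) =
          ENNReal.ofReal (Real.exp (3 * (1 / (2 + ρ)) * σ)) • (volume : Measure (EuclideanSpace ℝ (Fin 3)))))
    {σ : ℝ} (hσ : 0 ≤ σ) :
    ∀ᵐ y ∂(volume : Measure (EuclideanSpace ℝ (Fin 3))),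
      (IntervalIntegrable (fun s => G (Ψ s y) (selfSimilarTransport (1 / (2 + ρ)) 0 V (Ψ s y))) volume 0 σ ∧
        V (Ψ σ y) = V y - ∫ s in (0 : ℝ)..σ, G (Ψ s y) (selfSimilarTransport (1 / (2 + ρ)) 0 V (Ψ s y))) ∧
      (IntervalIntegrable (fun s => ⟪G (Ψ s y) (selfSimilarTransport (1 / (2 + ρ)) 0 V (Ψ s y)) + (1 - 1 / (2 + ρ)) • V (Ψ s y),
          selfSimilarTransport (1 / (2 + ρ)) 0 V (Ψ s y)⟫) volume 0 σ ∧
        P (Ψ σ y) = P y + ∫ s in (0 : ℝ)..σ, ⟪G (Ψ s y) (selfSimilarTransport (1 / (2 + ρ)) 0 V (Ψ s y)) + (1 - 1 / (2 + ρ)) • V (Ψ s y),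
          selfSimilarTransport (1 / (2 + ρ)) 0 V (Ψ s y)⟫) := by
  obtain ⟨hsw, hH, hgauge⟩ := hcls
  obtain ⟨hu, hp⟩ := hss
  obtain ⟨hVG, hG2, hV6, -⟩ := hPG
  obtain ⟨hΨm, -, hcurve, -, hjac⟩ := hΨ
  have hγ : (0 : ℝ) ≤ 1 / (2 + ρ) := by positivity
  -- ### the class data for the LINE's gradient `G` (as in `bernoulliClock`)
  have hA : ∀ a : ℝ, 0 < a → ENNReal.ofReal (a ^ (2 * ρ)) *
      cknA a (0 : ℝ × EuclideanSpace ℝ (Fin 3)) u ≤ (c : ℝ≥0∞) :=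
    fun a ha => le_trans (le_trans le_self_add le_self_add) (hgauge a ha)
  have hE : ∀ a : ℝ, 0 < a → ENNReal.ofReal (a ^ ρ) *
      cknE a (0 : ℝ × EuclideanSpace ℝ (Fin 3)) H ≤ (c : ℝ≥0∞) :=
    fun a ha => le_trans (le_trans le_add_self le_self_add) (hgauge a ha)
  have hD : ∀ a : ℝ, 0 < a → ENNReal.ofReal (a ^ (2 * ρ)) *
      cknD a (0 : ℝ × EuclideanSpace ℝ (Fin 3)) p ≤ (c : ℝ≥0∞) :=
    fun a ha => le_trans le_add_self (hgauge a ha)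
  have hu' : ∀ τ : ℝ, τ < 0 → u τ = fun x => selfSimilarCollapse (1 / (2 + ρ)) 0 V τ (x - 0) :=
    fun τ hτ => by rw [hu τ hτ]; funext x; rw [sub_zero]
  have hp' : ∀ τ : ℝ, τ < 0 → p τ = fun x => selfSimilarCollapsePressure (1 / (2 + ρ)) 0 P τ (x - 0) :=
    fun τ hτ => by rw [hp τ hτ]; funext x; rw [sub_zero]
  obtain ⟨G', hVm, hPm, -, -, -, -, -, -, -, -, hP32, hdiv, heq, -, -⟩ :=
    Past.profileData_of_past hρ hρh le_rfl le_rfl 0 hsw.distributional hH hA hE hD hu' hp'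
  have hPgrad := WeakPressure.hasWeakFDerivOn_pressure (γ := 1 / (2 + ρ)) hVm hPm hV6 hVG hG2 hP32 hdiv heq
  filter_upwards [velocity_transport hγ hVG hG2 hV6 hΨm hcurve hjac hσ, pressure_transport hγ hVG hG2 hV6 hPgrad hΨm hcurve hjac hσ]
    with y hy1 hy2
  exact ⟨hy1, hy2⟩

end Member

end Summit.NavierStokesRegularity.NavierStokesRegularity.Theorems.PowerGaugeEulerLiouville.WeakLagrangian

end
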